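import Summits.QuantumFields.BalabanUV.Beta.GAN24.Push3LegTelescope
import Summits.QuantumFields.BalabanUV.Beta.GAN24.RespStepBm
import Summits.QuantumFields.BalabanUV.Beta.GAN24.RespStepBmGaugeLaw
import Summits.QuantumFields.BalabanUV.Beta.KernelWardRelative
import Literature.MathematicalPhysics.QuantumFieldTheory.Balaban1983to89.Beta.AveragingWardStencils

/-!
# `BalabanUV.Beta.GAN24.PushRowCoarseWard` — binder row G-an2-4 ∕ (CONV-C), W-slot CT-W, route «WC-TL» ∕ «QR-LL», the (LT) row's contribution to the OWNER
# gan24-p1 g30's Q-g30-1 («is the consumer's multiplier column coarse-smooth?», W4 (3) l.46840) and to leaf-03 g63's «PAIR-COARSE» law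
# (`WardPairingCoarse(Step)` §5: `codiff₁` of the multiplier column of `G ∘ W` = `−(border normalisation)⁻¹ ×` the block mean of the ROW codifferential
# `codiff₁ (κ u ↦ W u x (inl κ) b)` of the kernel `W`): **THE COARSE ROW CODIFFERENTIAL OF A THREE-LEG PUSH IS THE PUSH WITH THE LEFT LEG REPLACED BY ITS
# COARSE WARD DATUM — for the literal's dressed legs `T_m = respStepBm ρ Lc (Lc^m) (Lc^(m+1))` that datum is the LEVEL-FREE pure gauge `(Lc^{d+1})⁻¹·dz 𝟙_{B(y)}`
# (`gaugeWt Lc y`), so the transported letter `push₃ (−T_m) T_m T_m S κ′ u′`, read as a kernel, has coarse row codifferential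
# `= −(Lc^{d+1})⁻¹ ×` THE GAUGE-LEFT CELL OF THE BLOCK INDICATOR `push₃ (dz 𝟙_{B(y)}) T_m T_m S κ′ u′`**
# (G-an2-4 formalisation swarm → CRUX TEAM (2), leaf prover `b2b-balaban-gan24-formalise-leaf-01`, gen 69; the located naming remark of my ONLINE line
# [LEAF01-G69-W1], journal `CLAIMS.log` l.47169: leaf-03's `codiff₁ W^F_{x,b}` is the ROW-index codifferential of the kernel `W`, not row (CC)'s slot divergence)

NOT IN PRINT; OUR BOOKKEEPING ([folklore] linearity of leaf-01's `Push3.push₃` in its LEFT leg family on the summable class (`Push3LegTelescope.push₃_sub_left ∕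
_add_left ∕ _smul_left`, the entry formula `Push3.push₃_inl_inl`), leaf-06∕leaf-12∕the OWNER's dressed one-step gauge law `RespStepBmGaugeLaw.dressedLeg_KStepUnit_exact_eq`
at the indicator potential `𝟙_{y}` (⇔ d1-leaf-07's ℋ-column Ward law `KernelWardHColumnWall.colH_ward_KInvStep_all` in the literal's leg units), an1's pure-gauge weight
`KernelWardRelative.gaugeWt`, an2∕an5's unit-vector bridge `AveragingWardStencils.b6UnitVec_eq`; generic `d`; 0 `def`, 0 cited facts, 0 `def … : Prop`, 0 sorry).  HONEST FRAMING (cell contract, verbatim): «discharging `BetaPertH` makes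
Bałaban's UV stability UNCONDITIONAL — a real constructive-QFT result; it is NOT the continuum limit and NOT the Clay problem.»  HONEST DEPENDENCY (verbatim): «continuum
YM on T⁴ ⇐ BetaPertH ∧ nine spine estimates (0/9 proved); BetaPertH ⇐ (D1) ∧ (D4) ∧ CAP+tail; G-an2-4 gates asym, D1 and NE2/3/4.»

## Why
leaf-03 g63's law (`WardPairingCoarse.pow_mul_codiff₁_multiplierCol_eq`, step form `WardPairingCoarseStep.stepScale_mul_pow_mul_codiff₁_multiplierCol_eq`): for EVERY
relative inverse `G` of an2's bordered (step) Hessian and EVERY spread kernel `W`,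
`(norm.)·codiff₁ (κ y ↦ (G∘W)(N•y) x (inr κ) b) y₀ = −blockSum N (codiff₁ (κ u ↦ W u x (inl κ) b)) y₀` — the multiplier column is exactly as coarse-smooth as
the kernel `W` is WARD-COVARIANT IN ITS ROW (first, fine field-bond) INDEX on block average.  Two readings of the consumer's `W` are on the table for the (DL) binder
(an2's to choose): (i) the row index of `W` is the transported letter's SLOT — then `codiff₁ W^F` is the slot divergence `divV` and the block FLUX of row (DIV)
(leaf-03 PART 3 `WardPairingCoarseFlux`, under a displayed assembly hypothesis); (ii) the row index of `W` is the transported letter's KERNEL row — the letter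
`push₃ (−T_m) T_m T_m S κ′ u′` (`WardRemainderTransportedLetter.transport_unitStepMap_eq_cubic_push₃`) IS a kernel at each coarse slot `(κ′, u′)`, no hypothesis
needed.  THIS FILE types reading (ii)'s right side in closed form: the ROW of the push enters only through the LEFT leg, slice by slice (§1), so its coarse
codifferential is the push with the left leg's coarse codifferential as leg (§2), and for the literal's dressed response family that codifferential is the
level-free pure gauge `(Lc^{d+1})⁻¹·gaugeWt Lc y` of the block indicator (§3) — whence §4: the row codifferential of the one-step transported letter is
`−(Lc^{d+1})⁻¹ ×` a GAUGE-LEFT CELL, the object the (LT) row bounds through coarse envelopes (`LayerPushGaugeLeft.abs_push₃_gaugeLeft_le_weighted`, leaf-01 g63: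
its left leg `dz 𝟙_{B(y)}` lives on the `Lc^d·2(d+1)` bonds crossing `∂B(y)` out of the block's `(d+1)·Lc^{d+1}`).  So under reading (ii) the OWNER's W4 (3)
hypothesis «ONE coarse summation by parts buys one power of `Lc` iff the column's coarse divergence is `Lc⁻¹ ×` itself» is, for the literal, EXACTLY the
face∕volume ratio of a gauge-left cell against the plain cell — a count the (LT) ledger already carries; under reading (i) it is FLUX-REC's.  Nothing here
decides between (i) and (ii) or evaluates either count.

## What (generic `d`; leg families `l r w : Fin (d+1) → Site → Fin (d+1) → Site → ℝ`, table `S` a stencil family)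
* §1 **`push₃_row_eq_of_slice_eq`** (hypothesis-free): the `(x′, inl α)` row of `push₃ l r w S κ′ u′` depends on `l` only through the slice `l α x′`;
  **`push₃_finset_sum_left`**: finite additivity in the left leg on the summable class (induction on `push₃_add_left`).
* §2 **`codiff₁_push₃_row_eq`** (summable class): `codiff₁ (α x ↦ push₃ l r w S κ′ u′ x z′ (inl α) b) y = push₃ (δᶜl) r w S κ′ u′ y z′ (inl α₀) b` with the
  direction-constant leg family `δᶜl _ x κ u := Σ_α (l α (x − e_α) κ u − l α x κ u)` (any `α₀`); **`codiff₁_push₃_row_eq_smul_of_ward`**: under a DISPLAYED coarse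
  Ward law of the left leg `Σ_α (l α (x − e_α) κ u − l α x κ u) = c·g x κ u` the row codifferential is `c·push₃ (fun _ ↦ g) r w S κ′ u′ y z′ (inl α₀) b`.
* §3 **`sum_respStepBm_sub_eq_gaugeWt`**: the literal's dressed one-step response family obeys the coarse Ward law with the LEVEL-FREE constant
  `Σ_α (T_m α (y − e_α) κ u − T_m α y κ u) = (Lc^{d+1})⁻¹·gaugeWt Lc y κ u` (`dressedLeg_KStepUnit_exact_eq` at `ψ = 𝟙_{y}`); `sum_neg_respStepBm_sub_eq` for `−T_m`.
* §4 **`codiff₁_push₃_literal_row_eq`**: for every in-block root, level `m`, decaying `K̃_m = KStepUnit Lc m`, `LocStencil S Cs δ` (`δ > 0`), coarse slot `(κ′, u′)`,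
  column `(z′, b)` and row block `y`:
  `codiff₁ (α x ↦ push₃ (−T_m) T_m T_m S κ′ u′ x z′ (inl α) b) y = −(Lc^{d+1})⁻¹·push₃ (fun _ ↦ gaugeWt Lc) T_m T_m S κ′ u′ y z′ (inl α₀) b`;
  `codiff₁_push₃_negDressed_row_eq` — the same with ARBITRARY right∕table legs on the summable class (the U-table cells of row (CC), the undressed chart);
  §5 **`blockSum_codiff₁_push₃_literal_row_eq`**: its block sum — the right side of leaf-03's law for `W :=` the transported letter — is
  `−(Lc^{d+1})⁻¹·Σ_{v ∈ box Lc} push₃ (fun _ ↦ gaugeWt Lc) T_m T_m S κ′ u′ (Lc•y₀ + v) z′ (inl α₀) b` (one `rw` away from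
  `WardPairingCoarseStep.stepScale_mul_pow_mul_codiff₁_multiplierCol_eq` once that file is in the tree; not imported here).
Identities only: NO size of any cell is asserted, NO power of `Lc` claimed; the choice (i)∕(ii) and the count are an2's ∕ the OWNER's (Q-g30-1).  Decides nothing about
(Q-R) ∕ (DIV) ∕ (DL) ∕ K-LL-4′; NOTHING of (LT) ∕ (LAY) ∕ (S) ∕ «T2Shape» ∕ (hW, hWall) discharged; 0 wall binders; NEVER «G-an2-4 closed» as (CONV-C); NOT D1, NOT `BetaPertH`,
NOT continuum, NOT Clay; not in print — our bookkeeping.  2026-08-22; no existing file touched.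
-/

noncomputable section

open Finset
open scoped BigOperators
open Literature.MathematicalPhysics.QuantumFieldTheory
open Literature.MathematicalPhysics.QuantumFieldTheory.Balaban1983to89
open Literature.MathematicalPhysics.QuantumFieldTheory.Balaban1983to89.Beta
open ExpKernelCalculus (MKer Decays)
open AffineAveraging (Form0 Form1 box toSite dz codiff₁ blockSum)
open AveragingContours (blk)
open OneStepResolventKernel (Fib LocStencil)
open OneStepKernelFamily (colH)
open Summit.QuantumFields.BalabanUV.Beta.AxialDressingRooted (coDressKBmAt)
open Summit.QuantumFields.BalabanUV.Beta.KernelWardRelative (gaugeWt)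
open Summit.QuantumFields.BalabanUV.Beta.GAN24.CombesThomas (KStepUnit)
open Summit.QuantumFields.BalabanUV.Beta.GAN24.Push3 (push₃ push₃_inl_inl push₃_inr_right)
open Summit.QuantumFields.BalabanUV.Beta.GAN24.Push3LegTelescope (push₃_sub_left push₃_add_left push₃_smul_left)
open Summit.QuantumFields.BalabanUV.Beta.GAN24.RespStepBm (respStepBm colH_coDressKBmAt_KStepUnit legDecay_respStepBm_of_decays
  legDecay_neg_respStepBm_of_decays)
open Summit.QuantumFields.BalabanUV.Beta.GAN24.RespStepBmGaugeLaw (dressedLeg_KStepUnit_exact_eq)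

namespace Summit.QuantumFields.BalabanUV.Beta.GAN24.PushRowCoarseWard

variable {d : ℕ}

/-! ## §1 The push reads its left leg slice by slice; finite additivity in the left leg -/

section Slice

variable (l l₂ r w : Fin (d + 1) → (Fin (d + 1) → ℤ) → Fin (d + 1) → (Fin (d + 1) → ℤ) → ℝ)
  (S : Fin (d + 1) → (Fin (d + 1) → ℤ) → MKer (d + 1) (Fib d))

/-- [folklore] **THE `(x′, inl α)` ROW OF THE PUSH READS ONLY THE SLICE `l α x′` OF THE LEFT LEG** (the entry formula `Push3.push₃_inl_inl`; multiplier columns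
vanish): two left leg families with the same slice at `(α, x′)` resp. `(α₂, x₂)` give the same row, whatever the other slices. -/
theorem push₃_row_eq_of_slice_eq {α α₂ : Fin (d + 1)} {x' x₂ : Fin (d + 1) → ℤ} (h : l α x' = l₂ α₂ x₂)
    (κ' : Fin (d + 1)) (u' z' : Fin (d + 1) → ℤ) (b : Fib d) :
    push₃ l r w S κ' u' x' z' (Sum.inl α) b = push₃ l₂ r w S κ' u' x₂ z' (Sum.inl α₂) b := by
  rcases b with β | ν
  · rw [push₃_inl_inl, push₃_inl_inl]
    refine tsum_congr fun z => Finset.sum_congr rfl fun κ₂ _ => ?_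
    congr 1
    refine tsum_congr fun x => Finset.sum_congr rfl fun κ₁ _ => ?_
    rw [h]
  · rw [push₃_inr_right, push₃_inr_right]

variable {r w S}

/-- [folklore] **`push₃` IS FINITELY ADDITIVE IN THE LEFT LEG FAMILY ON THE SUMMABLE CLASS**: left legs uniformly BOUNDED with SUMMABLE fine rows, right legs with
SUMMABLE fine columns, table legs BOUNDED, table `LocStencil S Cs δ` (`0 < δ`) ⟹ `push₃ (Σ_{i∈s} L i) r w S κ′ u′ = Σ_{i∈s} push₃ (L i) r w S κ′ u′`
(induction on `Push3LegTelescope.push₃_add_left`). -/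
theorem push₃_finset_sum_left {ι : Type*} (s : Finset ι)
    (L : ι → Fin (d + 1) → (Fin (d + 1) → ℤ) → Fin (d + 1) → (Fin (d + 1) → ℤ) → ℝ) {C Cw Cs δ : ℝ}
    (hL : ∀ i α x' κ x, |L i α x' κ x| ≤ C) (hLs : ∀ i α x' κ, Summable fun x => L i α x' κ x)
    (hrs : ∀ β z' κ, Summable fun z => r β z' κ z) (hw : ∀ κ' u' κ u, |w κ' u' κ u| ≤ Cw) (hS : LocStencil S Cs δ) (hδ : 0 < δ)
    (κ' : Fin (d + 1)) (u' : Fin (d + 1) → ℤ) :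
    push₃ (∑ i ∈ s, L i) r w S κ' u' = ∑ i ∈ s, push₃ (L i) r w S κ' u' := by
  classical
  induction s using Finset.induction_on with
  | empty =>
    rw [Finset.sum_empty, Finset.sum_empty]
    have h := push₃_smul_left (0 : Fin (d + 1) → (Fin (d + 1) → ℤ) → Fin (d + 1) → (Fin (d + 1) → ℤ) → ℝ) r w S (0 : ℝ) κ' u'
    rwa [zero_smul, zero_smul] at h
  | insert a s ha ih =>
    have hsum : ∀ α x' κ x, |(∑ i ∈ s, L i) α x' κ x| ≤ s.card * C := fun α x' κ x => by
      simp only [Finset.sum_apply]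
      refine (Finset.abs_sum_le_sum_abs _ _).trans ?_
      have h := Finset.sum_le_card_nsmul s (fun i => |L i α x' κ x|) C (fun i _ => hL i α x' κ x)
      rwa [nsmul_eq_mul] at h
    have hsums : ∀ α x' κ, Summable fun x => (∑ i ∈ s, L i) α x' κ x := fun α x' κ =>
      (summable_sum (s := s) fun i _ => hLs i α x' κ).congr fun x => by simp only [Finset.sum_apply]
    rw [Finset.sum_insert ha, Finset.sum_insert ha,
      push₃_add_left (hL a) (hLs a) hsum hsums hrs hw hS hδ κ' u', ih]

end Slice

/-! ## §2 The coarse row codifferential of the push is the push with the codifferentiated left leg -/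

section RowCodiff

variable {l r w : Fin (d + 1) → (Fin (d + 1) → ℤ) → Fin (d + 1) → (Fin (d + 1) → ℤ) → ℝ}
  {S : Fin (d + 1) → (Fin (d + 1) → ℤ) → MKer (d + 1) (Fib d)} {Cl Cw Cs δ : ℝ}

/-- NOT IN PRINT; OUR BOOKKEEPING.  **THE COARSE ROW CODIFFERENTIAL OF THE THREE-LEG PUSH** (summable class: left legs BOUNDED with SUMMABLE fine rows, right
legs with SUMMABLE fine columns, table legs BOUNDED, `LocStencil S Cs δ`, `0 < δ`): for every coarse slot `(κ′, u′)`, column `(z′, b)`, row block `y` and any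
direction `α₀`,
`codiff₁ (α x ↦ push₃ l r w S κ′ u′ x z′ (inl α) b) y = push₃ (fun _ x κ u ↦ Σ_α (l α (x − e_α) κ u − l α x κ u)) r w S κ′ u′ y z′ (inl α₀) b`
— the row enters only through the left leg (§1), the `2(d+1)` rows are frozen slices, and `push₃` is additive in them. -/
theorem codiff₁_push₃_row_eq (hl : ∀ α x' κ x, |l α x' κ x| ≤ Cl) (hls : ∀ α x' κ, Summable fun x => l α x' κ x)
    (hrs : ∀ β z' κ, Summable fun z => r β z' κ z) (hw : ∀ κ' u' κ u, |w κ' u' κ u| ≤ Cw) (hS : LocStencil S Cs δ) (hδ : 0 < δ)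
    (κ' : Fin (d + 1)) (u' y z' : Fin (d + 1) → ℤ) (α₀ : Fin (d + 1)) (b : Fib d) :
    codiff₁ (fun α x => push₃ l r w S κ' u' x z' (Sum.inl α) b) y
      = push₃ (fun _ x κ u => ∑ α, (l α (x - AffineAveraging.unitVec α) κ u - l α x κ u)) r w S κ' u' y z' (Sum.inl α₀) b := by
  -- the frozen difference slices, as direction- and site-constant leg families
  set D : Fin (d + 1) → (Fin (d + 1) → (Fin (d + 1) → ℤ) → Fin (d + 1) → (Fin (d + 1) → ℤ) → ℝ) :=
    fun α _ _ κ u => l α (y - AffineAveraging.unitVec α) κ u - l α y κ u with hD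
  have hterm : ∀ α, push₃ l r w S κ' u' (y - AffineAveraging.unitVec α) z' (Sum.inl α) b - push₃ l r w S κ' u' y z' (Sum.inl α) b
      = push₃ (D α) r w S κ' u' y z' (Sum.inl α₀) b := by
    intro α
    have e1 : push₃ l r w S κ' u' (y - AffineAveraging.unitVec α) z' (Sum.inl α) b
        = push₃ (fun _ _ => l α (y - AffineAveraging.unitVec α)) r w S κ' u' y z' (Sum.inl α₀) b :=
      push₃_row_eq_of_slice_eq l (fun _ _ => l α (y - AffineAveraging.unitVec α)) r w S rfl κ' u' z' b
    have e2 : push₃ l r w S κ' u' y z' (Sum.inl α) b = push₃ (fun _ _ => l α y) r w S κ' u' y z' (Sum.inl α₀) b :=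
      push₃_row_eq_of_slice_eq l (fun _ _ => l α y) r w S rfl κ' u' z' b
    have e3 : D α = (fun _ _ => l α (y - AffineAveraging.unitVec α)) - (fun _ _ => l α y) := by
      funext β x κ u; simp only [hD, Pi.sub_apply]
    rw [e1, e2, e3, push₃_sub_left (Cl := Cl) (Cl' := Cl) (fun _ _ κ x => hl α _ κ x) (fun _ _ κ => hls α _ κ)
      (fun _ _ κ x => hl α y κ x) (fun _ _ κ => hls α y κ) hrs hw hS hδ κ' u']
    simp only [Pi.sub_apply]
  have hCl : 0 ≤ Cl := (abs_nonneg _).trans (hl 0 0 0 0)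
  have hDb : ∀ α β x κ u, |D α β x κ u| ≤ Cl + Cl := fun α β x κ u => by
    simp only [hD]
    exact (abs_sub _ _).trans (add_le_add (hl _ _ _ _) (hl _ _ _ _))
  have hDs : ∀ α β x κ, Summable fun u => D α β x κ u := fun α β x κ =>
    ((hls α (y - AffineAveraging.unitVec α) κ).sub (hls α y κ)).congr fun u => by simp only [hD]
  calc codiff₁ (fun α x => push₃ l r w S κ' u' x z' (Sum.inl α) b) y
      = ∑ α, push₃ (D α) r w S κ' u' y z' (Sum.inl α₀) b := by
        simp only [AffineAveraging.codiff₁]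
        exact Finset.sum_congr rfl fun α _ => hterm α
    _ = (∑ α, push₃ (D α) r w S κ' u') y z' (Sum.inl α₀) b := by simp only [Finset.sum_apply]
    _ = push₃ (∑ α, D α) r w S κ' u' y z' (Sum.inl α₀) b := by
        rw [push₃_finset_sum_left Finset.univ D hDb hDs hrs hw hS hδ κ' u']
    _ = push₃ (fun _ x κ u => ∑ α, (l α (x - AffineAveraging.unitVec α) κ u - l α x κ u)) r w S κ' u' y z' (Sum.inl α₀) b :=
        push₃_row_eq_of_slice_eq _ _ r w S (by funext κ u; simp only [hD, Finset.sum_apply]) κ' u' z' b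

/-- NOT IN PRINT; OUR BOOKKEEPING.  **UNDER A DISPLAYED COARSE WARD LAW OF THE LEFT LEG THE ROW CODIFFERENTIAL IS `c ×` THE PUSH WITH THE WARD DATUM AS LEFT LEG**:
if `Σ_α (l α (x − e_α) κ u − l α x κ u) = c·g x κ u` for all `x κ u` (the socket shape of an1's `hH` ∕ d1-leaf-07's ℋ-column Ward law), then
`codiff₁ (α x ↦ push₃ l r w S κ′ u′ x z′ (inl α) b) y = c·push₃ (fun _ ↦ g) r w S κ′ u′ y z′ (inl α₀) b`. -/
theorem codiff₁_push₃_row_eq_smul_of_ward (hl : ∀ α x' κ x, |l α x' κ x| ≤ Cl) (hls : ∀ α x' κ, Summable fun x => l α x' κ x)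
    (hrs : ∀ β z' κ, Summable fun z => r β z' κ z) (hw : ∀ κ' u' κ u, |w κ' u' κ u| ≤ Cw) (hS : LocStencil S Cs δ) (hδ : 0 < δ)
    (g : (Fin (d + 1) → ℤ) → Fin (d + 1) → (Fin (d + 1) → ℤ) → ℝ) (c : ℝ)
    (hW : ∀ x κ u, ∑ α, (l α (x - AffineAveraging.unitVec α) κ u - l α x κ u) = c * g x κ u)
    (κ' : Fin (d + 1)) (u' y z' : Fin (d + 1) → ℤ) (α₀ : Fin (d + 1)) (b : Fib d) :
    codiff₁ (fun α x => push₃ l r w S κ' u' x z' (Sum.inl α) b) y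
      = c * push₃ (fun _ => g) r w S κ' u' y z' (Sum.inl α₀) b := by
  rw [codiff₁_push₃_row_eq hl hls hrs hw hS hδ κ' u' y z' α₀ b]
  have e : (fun (_ : Fin (d + 1)) (x : Fin (d + 1) → ℤ) (κ : Fin (d + 1)) (u : Fin (d + 1) → ℤ) =>
      ∑ α, (l α (x - AffineAveraging.unitVec α) κ u - l α x κ u))
      = c • (fun (_ : Fin (d + 1)) => g) := by
    funext β x κ u
    simp only [Pi.smul_apply, smul_eq_mul]
    exact hW x κ u
  rw [e, push₃_smul_left, Pi.smul_apply, Pi.smul_apply, Pi.smul_apply, Pi.smul_apply, smul_eq_mul]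

end RowCodiff

/-! ## §3 The literal's dressed one-step response family obeys the coarse Ward law with a level-free constant -/

section DressedWard

variable {Lc : ℕ} [NeZero Lc] {r : Fin (d + 1) → ℕ}

/-- NOT IN PRINT; OUR BOOKKEEPING (`RespStepBmGaugeLaw.dressedLeg_KStepUnit_exact_eq` at the indicator potential `ψ = 𝟙_{y}` + `RespStepBm.colH_coDressKBmAt_KStepUnit`).
**THE COARSE WARD LAW OF THE DRESSED ONE-STEP RESPONSE FAMILY, LEVEL-FREE CONSTANT**: for every in-block root `toSite r`, every level `m`, every coarse block `y` and fine
bond `(κ, u)`,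
`Σ_α (T_m α (y − e_α) κ u − T_m α y κ u) = (Lc^{d+1})⁻¹·gaugeWt Lc y κ u`,  `T_m = respStepBm (toSite r) Lc (Lc^m) (Lc^(m+1))`
— the response to the coarse pure-gauge multiplier datum `dᵀδ_y` is the fine pure gauge of the block indicator, `(Lc^m)^{d+2}` already absorbed in the leg units
(d1-leaf-07's `KernelWardHColumnWall.colH_ward_KInvStep_all` in the literal's currency). -/
theorem sum_respStepBm_sub_eq_gaugeWt (hr : r ∈ box (d + 1) Lc) (m : ℕ) (y : Fin (d + 1) → ℤ) (κ : Fin (d + 1)) (u : Fin (d + 1) → ℤ) :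
    ∑ α, (respStepBm (toSite r) Lc (Lc ^ m) (Lc ^ (m + 1)) α (y - AffineAveraging.unitVec α) κ u
        - respStepBm (toSite r) Lc (Lc ^ m) (Lc ^ (m + 1)) α y κ u)
      = (((Lc : ℝ) ^ (d + 1))⁻¹) * gaugeWt Lc y κ u := by
  classical
  set ψ : (Fin (d + 1) → ℤ) → ℝ := fun z => if z = y then 1 else 0 with hψ
  have hψs : Summable ψ := summable_of_ne_finset_zero (s := {y}) (fun z hz => by
    rw [Finset.mem_singleton] at hz
    simp only [hψ, if_neg hz])
  have h := congrFun (congrFun (dressedLeg_KStepUnit_exact_eq (d := d) hr m hψs) κ) u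
  simp only [colH_coDressKBmAt_KStepUnit] at h
  -- the left side: the indicator potential reads the two slices `y − e_α` and `y`
  have hin : ∀ α, ∑' z, dz ψ α z * respStepBm (toSite r) Lc (Lc ^ m) (Lc ^ (m + 1)) α z κ u
      = respStepBm (toSite r) Lc (Lc ^ m) (Lc ^ (m + 1)) α (y - AffineAveraging.unitVec α) κ u
          - respStepBm (toSite r) Lc (Lc ^ m) (Lc ^ (m + 1)) α y κ u := by
    intro α
    set T := respStepBm (toSite r) Lc (Lc ^ m) (Lc ^ (m + 1)) with hT
    have hs1 : Summable fun z => ψ (z + AffineAveraging.unitVec α) * T α z κ u :=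
      summable_of_ne_finset_zero (s := {y - AffineAveraging.unitVec α}) (fun z hz => by
        rw [Finset.mem_singleton] at hz
        have hz' : z + AffineAveraging.unitVec α ≠ y := fun e => hz (by rw [← e, add_sub_cancel_right])
        simp only [hψ, if_neg hz', zero_mul])
    have hs2 : Summable fun z => ψ z * T α z κ u :=
      summable_of_ne_finset_zero (s := {y}) (fun z hz => by
        rw [Finset.mem_singleton] at hz
        simp only [hψ, if_neg hz, zero_mul])
    have e1 : ∑' z, ψ (z + AffineAveraging.unitVec α) * T α z κ u = T α (y - AffineAveraging.unitVec α) κ u := by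
      rw [tsum_eq_single (y - AffineAveraging.unitVec α) (fun z hz => by
        have hz' : z + AffineAveraging.unitVec α ≠ y := fun e => hz (by rw [← e, add_sub_cancel_right])
        simp only [hψ, if_neg hz', zero_mul])]
      simp only [hψ, sub_add_cancel, if_true, one_mul]
    have e2 : ∑' z, ψ z * T α z κ u = T α y κ u := by
      rw [tsum_eq_single y (fun z hz => by simp only [hψ, if_neg hz, zero_mul])]
      simp only [hψ, if_true, one_mul]
    calc ∑' z, dz ψ α z * T α z κ u
        = ∑' z, (ψ (z + AffineAveraging.unitVec α) * T α z κ u - ψ z * T α z κ u) :=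
          tsum_congr fun z => by simp only [AffineAveraging.dz, sub_mul]
      _ = (∑' z, ψ (z + AffineAveraging.unitVec α) * T α z κ u) - ∑' z, ψ z * T α z κ u := hs1.tsum_sub hs2
      _ = T α (y - AffineAveraging.unitVec α) κ u - T α y κ u := by rw [e1, e2]
  rw [Finset.sum_congr rfl (fun α _ => hin α)] at h
  rw [h]
  -- the right side: the block-constant lift of the indicator is the pure-gauge weight of the block `y`
  simp only [AffineAveraging.dz, KernelWardRelative.gaugeWt, hψ, AveragingWardStencils.b6UnitVec_eq]
  split_ifs <;> ring

/-- NOT IN PRINT; OUR BOOKKEEPING.  The same for the NEGATED family (the literal's LEFT kernel leg is `−T_m`): constant `−(Lc^{d+1})⁻¹`. -/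
theorem sum_neg_respStepBm_sub_eq (hr : r ∈ box (d + 1) Lc) (m : ℕ) (y : Fin (d + 1) → ℤ) (κ : Fin (d + 1)) (u : Fin (d + 1) → ℤ) :
    ∑ α, ((-respStepBm (toSite r) Lc (Lc ^ m) (Lc ^ (m + 1))) α (y - AffineAveraging.unitVec α) κ u
        - (-respStepBm (toSite r) Lc (Lc ^ m) (Lc ^ (m + 1))) α y κ u)
      = -(((Lc : ℝ) ^ (d + 1))⁻¹) * gaugeWt Lc y κ u := by
  rw [neg_mul, ← sum_respStepBm_sub_eq_gaugeWt hr m y κ u, ← Finset.sum_neg_distrib]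
  refine Finset.sum_congr rfl fun α _ => ?_
  simp only [Pi.neg_apply]
  ring

end DressedWard

/-! ## §4 The instance: the coarse row codifferential of the one-step transported letter is a gauge-left cell of the block indicator -/

section Literal

variable {Lc : ℕ} [NeZero Lc] {r : Fin (d + 1) → ℕ}
  {S : Fin (d + 1) → (Fin (d + 1) → ℤ) → MKer (d + 1) (Fib d)} {Cs δ CK mK : ℝ}

/-- NOT IN PRINT; OUR BOOKKEEPING.  **THE LITERAL's LEFT LEG AGAINST ARBITRARY RIGHT∕TABLE LEGS** (summable class; e.g. the U-table cells of row (CC), or an undressed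
chart's legs): with `T_m = respStepBm (toSite r) Lc (Lc^m) (Lc^(m+1))`, `K̃_m = KStepUnit Lc m` decaying at a positive rate,
`codiff₁ (α x ↦ push₃ (−T_m) r′ w S κ′ u′ x z′ (inl α) b) y = −(Lc^{d+1})⁻¹·push₃ (fun _ ↦ gaugeWt Lc) r′ w S κ′ u′ y z′ (inl α₀) b`. -/
theorem codiff₁_push₃_negDressed_row_eq (hr : r ∈ box (d + 1) Lc) (m : ℕ) (hK : Decays (KStepUnit (d := d) Lc m) CK mK) (hmK : 0 < mK)
    {r' w : Fin (d + 1) → (Fin (d + 1) → ℤ) → Fin (d + 1) → (Fin (d + 1) → ℤ) → ℝ} {Cw : ℝ}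
    (hrs : ∀ β z' κ, Summable fun z => r' β z' κ z) (hw : ∀ κ' u' κ u, |w κ' u' κ u| ≤ Cw) (hS : LocStencil S Cs δ) (hδ : 0 < δ)
    (κ' : Fin (d + 1)) (u' y z' : Fin (d + 1) → ℤ) (α₀ : Fin (d + 1)) (b : Fib d) :
    codiff₁ (fun α x => push₃ (-respStepBm (toSite r) Lc (Lc ^ m) (Lc ^ (m + 1))) r' w S κ' u' x z' (Sum.inl α) b) y
      = -(((Lc : ℝ) ^ (d + 1))⁻¹) * push₃ (fun _ => gaugeWt Lc) r' w S κ' u' y z' (Sum.inl α₀) b := by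
  have hLc : 1 ≤ Lc := Nat.one_le_iff_ne_zero.2 (NeZero.ne Lc)
  have hnT := legDecay_neg_respStepBm_of_decays hLc hr hK hmK.le
  exact codiff₁_push₃_row_eq_smul_of_ward (fun α x' κ x => hnT.abs_le hmK.le α x' κ x) (fun α x' κ => hnT.summable hmK α x' κ)
    hrs hw hS hδ (gaugeWt Lc) _ (sum_neg_respStepBm_sub_eq hr m) κ' u' y z' α₀ b

/-- NOT IN PRINT; OUR BOOKKEEPING.  **THE COARSE ROW CODIFFERENTIAL OF THE LITERAL's ONE-STEP TRANSPORTED LETTER** `push₃ (−T_m) T_m T_m S κ′ u′`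
(`WardRemainderTransportedLetter.transport_unitStepMap_eq_cubic_push₃`'s ff channel at `k = 0`): for every in-block root, level `m` with `K̃_m` decaying at a positive rate,
`LocStencil S Cs δ` (`δ > 0`), coarse slot `(κ′, u′)`, column `(z′, b)`, row block `y` and direction `α₀`,
`codiff₁ (α x ↦ push₃ (−T_m) T_m T_m S κ′ u′ x z′ (inl α) b) y = −(Lc^{d+1})⁻¹·push₃ (fun _ ↦ gaugeWt Lc) T_m T_m S κ′ u′ y z′ (inl α₀) b`
— `−(Lc^{d+1})⁻¹ ×` THE GAUGE-LEFT CELL OF THE BLOCK INDICATOR (left leg `gaugeWt Lc y = dz 𝟙_{B(y)}`, supported on the bonds crossing `∂B(y)`; bounded through coarse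
envelopes by `LayerPushGaugeLeft.abs_push₃_gaugeLeft_le_weighted`).  Reading (ii) of the module docstring: this is the fine codifferential whose block mean leaf-03's
law turns into the coarse codifferential of the consumer's multiplier column. -/
theorem codiff₁_push₃_literal_row_eq (hr : r ∈ box (d + 1) Lc) (m : ℕ) (hK : Decays (KStepUnit (d := d) Lc m) CK mK) (hmK : 0 < mK)
    (hS : LocStencil S Cs δ) (hδ : 0 < δ) (κ' : Fin (d + 1)) (u' y z' : Fin (d + 1) → ℤ) (α₀ : Fin (d + 1)) (b : Fib d) :
    codiff₁ (fun α x => push₃ (-respStepBm (toSite r) Lc (Lc ^ m) (Lc ^ (m + 1))) (respStepBm (toSite r) Lc (Lc ^ m) (Lc ^ (m + 1)))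
        (respStepBm (toSite r) Lc (Lc ^ m) (Lc ^ (m + 1))) S κ' u' x z' (Sum.inl α) b) y
      = -(((Lc : ℝ) ^ (d + 1))⁻¹) * push₃ (fun _ => gaugeWt Lc) (respStepBm (toSite r) Lc (Lc ^ m) (Lc ^ (m + 1)))
          (respStepBm (toSite r) Lc (Lc ^ m) (Lc ^ (m + 1))) S κ' u' y z' (Sum.inl α₀) b := by
  have hLc : 1 ≤ Lc := Nat.one_le_iff_ne_zero.2 (NeZero.ne Lc)
  have hT := legDecay_respStepBm_of_decays hLc hr hK hmK.le
  exact codiff₁_push₃_negDressed_row_eq hr m hK hmK (fun β z' κ => hT.summable hmK β z' κ) (fun κ' u' κ u => hT.abs_le hmK.le κ' u' κ u)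
    hS hδ κ' u' y z' α₀ b

/-! ## §5 Its block sum — the right side of leaf-03's law for `W :=` the transported letter -/

/-- NOT IN PRINT; OUR BOOKKEEPING.  **THE BLOCK SUM OF THE TRANSPORTED LETTER's ROW CODIFFERENTIAL IS A BLOCK SUM OF GAUGE-LEFT CELLS**:
`blockSum Lc (codiff₁ (α x ↦ push₃ (−T_m) T_m T_m S κ′ u′ x z′ (inl α) b)) y₀ = −(Lc^{d+1})⁻¹·Σ_{v ∈ box Lc} push₃ (fun _ ↦ gaugeWt Lc) T_m T_m S κ′ u′ (Lc•y₀ + toSite v) z′ (inl α₀) b`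
— with `WardPairingCoarseStep.stepScale_mul_pow_mul_codiff₁_multiplierCol_eq` (leaf-03 g63, in flight) at `W := push₃ (−T_m) T_m T_m S κ′ u′` this is the coarse
codifferential of the consumer's multiplier column of `G_{m+1} ∘ W`, times `−(stepScale_{m+1}·Lc^{d+1})`. -/
theorem blockSum_codiff₁_push₃_literal_row_eq (hr : r ∈ box (d + 1) Lc) (m : ℕ) (hK : Decays (KStepUnit (d := d) Lc m) CK mK) (hmK : 0 < mK)
    (hS : LocStencil S Cs δ) (hδ : 0 < δ) (κ' : Fin (d + 1)) (u' y₀ z' : Fin (d + 1) → ℤ) (α₀ : Fin (d + 1)) (b : Fib d) :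
    blockSum Lc (codiff₁ (fun α x => push₃ (-respStepBm (toSite r) Lc (Lc ^ m) (Lc ^ (m + 1)))
        (respStepBm (toSite r) Lc (Lc ^ m) (Lc ^ (m + 1))) (respStepBm (toSite r) Lc (Lc ^ m) (Lc ^ (m + 1))) S κ' u' x z' (Sum.inl α) b)) y₀
      = -(((Lc : ℝ) ^ (d + 1))⁻¹) * ∑ v ∈ box (d + 1) Lc, push₃ (fun _ => gaugeWt Lc) (respStepBm (toSite r) Lc (Lc ^ m) (Lc ^ (m + 1)))
          (respStepBm (toSite r) Lc (Lc ^ m) (Lc ^ (m + 1))) S κ' u' ((Lc : ℤ) • y₀ + toSite v) z' (Sum.inl α₀) b := by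
  simp only [AffineAveraging.blockSum]
  rw [Finset.mul_sum]
  exact Finset.sum_congr rfl fun v _ => codiff₁_push₃_literal_row_eq hr m hK hmK hS hδ κ' u' _ z' α₀ b

end Literal

end Summit.QuantumFields.BalabanUV.Beta.GAN24.PushRowCoarseWard

end
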